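import Summits.RiemannHypothesis.RiemannHypothesis.Theorems.PfPersistenceCoefficientRigiditySpectral
import Summits.RiemannHypothesis.RiemannHypothesis.Theorems.PfPersistenceCoefficientRigidityDefectEnergy
import HarnessLib

/-!
# Coefficient rigidity of window positivity, VIII-b: the SYMBOL CRITERION
(pub-rhpf cand-7, gen 9; mechanism/rigidity campaign; no RH claims)

Eighth part of `PfPersistenceCoefficientRigidity`, second half — the capstone of the series.
For a finitely supported even perturbation `∑_{i ∈ E} c_i (δ_{x_i} + δ_{-x_i})` of `ζ`'s
explicit-formula measure (arbitrary real sites `x_i`, repetitions and the origin allowed) with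
SYMBOL `P(t) = ∑_i c_i cos(t x_i)`:

* `multiSiteQuadratic_nonneg_iff_symbol` — **SYMBOL CRITERION (RH-free statement)**:
  `(∀ g test, 0 ≤ Re Q_{E,c,x}(g)) ↔ RiemannHypothesis ∧ (∀ t, 0 ≤ P(t))`.
  The perturbed form is positive on the test class iff RH holds AND the symbol is a nonnegative
  function.  (`c = 0`: Weil's criterion, imported; RH is NOT claimed.)
* `isGLB_multiDefectEnergySet_of_riemannHypothesis` — under RH the defect energy density
  `inf_g Re Q(g)/‖g‖₂²` is EXACTLY `2 inf_t P(t)`;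
  `riemannHypothesis_iff_bddBelow_multiDefectEnergySet` — it is finite iff RH.
* Consequences: parts III-b/IV-b/VI/VII are the special cases "distinct positive sites"
  (a nonzero cosine sum with distinct positive frequencies takes negative values, part IV-a) and
  "one site"; NEW: `multiSiteQuadratic_nonneg_of_dominant_origin` — mass at the origin SHIELDS
  defects: if `x_{i₀} = 0` and `c_{i₀} ≥ ∑_{i ≠ i₀} |c_i|` the perturbed form is positive under RH;
  and `finiteEdit_positivity_iff_symbol` — the table version (entries `n = 0, 1` sit at the
  origin `log n = 0`).

Mechanism: lower bound = Plancherel on the critical line (part VIII-a, RH-free) + `W ≥ 0` (RH);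
upper bound = wave packets at a carrier near a near-minimiser of `P` and off the ordinates
(parts III-a, VI); `¬RH` = sinking ground energy (part I).  ALL STATEMENTS ARE PROVED (no
`sorry`, no new axioms, RH only as an explicit hypothesis or inside a `by_cases`); no sentence is
DATA.

References: E. Bombieri, Rend. Lincei (9) 11 (2000) 183–233, Thm. 1, §2; A. Weil (1952);
H. Yoshida (1992), §2.
-/

set_option linter.dupNamespace false

noncomputable section

open Complex Filter Set MeasureTheory
open scoped Real Topology ComplexConjugate NNReal

namespace Summit.RiemannHypothesis.RiemannHypothesis.Theorems.PfPersistenceCoefficientRigidity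

open Literature.NumberTheory.LFunctions
open Literature.NumberTheory.LFunctions.WeilConverse
open Summit.RiemannHypothesis.RiemannHypothesis.Theorems.PfPersistenceDownCone
open Summit.RiemannHypothesis.RiemannHypothesis.Theorems.PfPersistenceBarrier

/-! ## §40 A priori bounds -/

/-- `Re Q_{E,c,x}(g) ≤ Re W(g ⋆ g̃) + 2(∑|c_i|)‖g‖₂²`. [this work] -/
theorem multiSiteQuadratic_re_le {ι : Type*} (E : Finset ι) (c x : ι → ℝ) {g : ℝ → ℂ}
    (hg : IsWeilTest g) :
    (multiSiteQuadratic E c x g).re ≤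
      (weilQuadratic g).re + 2 * (∑ i ∈ E, |c i|) * ∫ u, ‖g u‖ ^ 2 := by
  rw [multiSiteQuadratic, Complex.add_re, Finset.mul_sum, Finset.sum_mul]
  have h := re_siteSum_le E c x hg
  linarith

/-- A uniform lower bound `B‖g‖₂² ≤ Re Q_{E,c,x}(g)` on the test class forces RH (sinking
ground energy under `¬RH`, part I). [this work] -/
theorem riemannHypothesis_of_multiSite_lower_bound {ι : Type*} {E : Finset ι} {c x : ι → ℝ}
    {B : ℝ} (hB : ∀ g : ℝ → ℂ, IsWeilTest g → 0 < ∫ u, ‖g u‖ ^ 2 →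
      B * ∫ u, ‖g u‖ ^ 2 ≤ (multiSiteQuadratic E c x g).re) :
    RiemannHypothesis := by
  by_contra hRH
  obtain ⟨a, -, -, g, hg, -, hnorm, hW⟩ :=
    exists_weilQuadratic_lt_of_not_riemannHypothesis hRH (|B| + 2 * ∑ i ∈ E, |c i|) 0
  have h1 := hB g hg (by rw [hnorm]; exact one_pos)
  have h2 := multiSiteQuadratic_re_le E c x hg
  rw [hnorm] at h1 h2
  linarith [neg_abs_le B]

/-! ## §41 The upper construction at a prescribed carrier -/

/-- **RH branch.**  Under RH, for every `t₁` and `ε > 0` some test function (a wave packet with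
carrier near `t₁`, off the ordinates) has `‖g‖₂ > 0` and
`Re Q_{E,c,x}(g) ≤ (2P(t₁) + ε)‖g‖₂²`. [this work] -/
theorem exists_multiSite_re_le_ratio_of_riemannHypothesis (hRH : RiemannHypothesis) {ι : Type*}
    (E : Finset ι) (c x : ι → ℝ) (t₁ : ℝ) {ε : ℝ} (hε : 0 < ε) :
    ∃ g : ℝ → ℂ, IsWeilTest g ∧ 0 < ∫ u, ‖g u‖ ^ 2 ∧
      (multiSiteQuadratic E c x g).re ≤ (2 * siteSymbol E c x t₁ + ε) * ∫ u, ‖g u‖ ^ 2 := by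
  -- carrier
  obtain ⟨η, hη, hball⟩ :=
    Metric.continuous_iff.1 (continuous_siteSymbol E c x) t₁ (ε / 4) (by positivity)
  have hab : t₁ - η / 2 < t₁ + η / 2 := by linarith
  obtain ⟨t₀, ht₀, d, hd, hsep⟩ := exists_far_from_ordinates hab
  have hP : siteSymbol E c x t₀ ≤ siteSymbol E c x t₁ + ε / 4 := by
    have hdist : dist t₀ t₁ < η := by
      rw [mem_Icc] at ht₀
      rw [Real.dist_eq, abs_lt]
      constructor <;> linarith
    have h := hball t₀ hdist
    rw [Real.dist_eq, abs_lt] at h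
    linarith [h.2]
  -- constants
  obtain ⟨K, hK⟩ := exists_plateau_lipschitz
  have hK0 : (0 : ℝ) ≤ K := K.2
  set A := ∑ i ∈ E, |c i| * |x i| with hA
  have hA0 : 0 ≤ A := Finset.sum_nonneg fun i _ ↦ mul_nonneg (abs_nonneg _) (abs_nonneg _)
  set S := ∑' ρ : ZetaZeros.riemannZetaNontrivialZeros, weilZeroWeight (ρ : ℂ) with hSdef
  set M := (weilDecayConst plateauC * ((1 + 2 * t₀ ^ 2) * (2 + 1 / d ^ 2))) ^ 2 with hMdef
  have hS : 0 ≤ S := tsum_nonneg fun ρ ↦ weilZeroWeight_nonneg ρ.2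
  have hM : 0 ≤ M := sq_nonneg _
  have hMS : 0 ≤ M * S := mul_nonneg hM hS
  have hKA : 0 ≤ (K : ℝ) * A := mul_nonneg hK0 hA0
  set R := max 1 ((4 * (M * S) + 16 * K * A + 1) / ε) with hRdef
  have hR1 : 1 ≤ R := le_max_left _ _
  have hR0 : 0 < R := by linarith
  have hRε : 4 * (M * S) + 16 * K * A + 1 ≤ ε * R := by
    have h := le_max_right 1 ((4 * (M * S) + 16 * K * A + 1) / ε)
    rw [← hRdef, div_le_iff₀ hε] at h
    linarith
  have hg := isWeilTest_wavePacket hR0 t₀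
  have hO0 : R ≤ overlap R 0 := le_overlap_zero hR0
  refine ⟨wavePacket R t₀, hg, ?_, ?_⟩
  · rw [integral_norm_sq_wavePacket]
    linarith
  rw [integral_norm_sq_wavePacket, multiSiteQuadratic_re,
    ← combShapeDetection_zeroForm_eq_weilQuadratic hg]
  simp_rw [re_weilConv_wavePacket_overlap]
  have hZ : (zeroForm (wavePacket R t₀)).re ≤ M / R ^ 2 * S :=
    re_zeroForm_wavePacket_le hRH hR0 hd hsep
  have hZ' : M / R ^ 2 * S ≤ M * S :=
    mul_le_mul_of_nonneg_right (div_le_self hM (by nlinarith)) hS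
  have hsplit : ∑ i ∈ E, 2 * c i * (Real.cos (t₀ * x i) * overlap R (x i)) =
      2 * overlap R 0 * siteSymbol E c x t₀ +
        2 * ∑ i ∈ E, c i * Real.cos (t₀ * x i) * (overlap R (x i) - overlap R 0) := by
    rw [siteSymbol, Finset.mul_sum, Finset.mul_sum, ← Finset.sum_add_distrib]
    exact Finset.sum_congr rfl fun i _ ↦ by ring
  have herr : ∑ i ∈ E, c i * Real.cos (t₀ * x i) * (overlap R (x i) - overlap R 0) ≤
      2 * K * A := by
    rw [hA, Finset.mul_sum]
    refine Finset.sum_le_sum fun i _ ↦ ?_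
    have h1 : |overlap R (x i) - overlap R 0| ≤ 2 * (K : ℝ) * |x i| :=
      abs_overlap_sub_overlap_zero_le hR0 hK _
    have h2 : |c i * Real.cos (t₀ * x i)| ≤ |c i| := by
      rw [abs_mul]
      exact mul_le_of_le_one_right (abs_nonneg _) (Real.abs_cos_le_one _)
    calc c i * Real.cos (t₀ * x i) * (overlap R (x i) - overlap R 0)
        ≤ |c i * Real.cos (t₀ * x i) * (overlap R (x i) - overlap R 0)| := le_abs_self _
      _ = |c i * Real.cos (t₀ * x i)| * |overlap R (x i) - overlap R 0| := abs_mul _ _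
      _ ≤ |c i| * (2 * (K : ℝ) * |x i|) := mul_le_mul h2 h1 (abs_nonneg _) (abs_nonneg _)
      _ = 2 * K * (|c i| * |x i|) := by ring
  have hmain : 2 * overlap R 0 * siteSymbol E c x t₀ ≤
      2 * overlap R 0 * (siteSymbol E c x t₁ + ε / 4) :=
    mul_le_mul_of_nonneg_left hP (by linarith)
  have h1 : M * S + 4 * K * A ≤ ε / 4 * overlap R 0 := by
    have : ε / 4 * R ≤ ε / 4 * overlap R 0 := mul_le_mul_of_nonneg_left hO0 (by positivity)
    linarith
  rw [hsplit]
  nlinarith [hO0]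

/-- **Upper construction (RH-free).**  For every `t₁` and `ε > 0` some test function with
`‖g‖₂ > 0` has `Re Q_{E,c,x}(g) ≤ (2P(t₁) + ε)‖g‖₂²`. [this work] -/
theorem exists_multiSite_re_le_ratio {ι : Type*} (E : Finset ι) (c x : ι → ℝ) (t₁ : ℝ) {ε : ℝ}
    (hε : 0 < ε) :
    ∃ g : ℝ → ℂ, IsWeilTest g ∧ 0 < ∫ u, ‖g u‖ ^ 2 ∧
      (multiSiteQuadratic E c x g).re ≤ (2 * siteSymbol E c x t₁ + ε) * ∫ u, ‖g u‖ ^ 2 := by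
  by_cases hRH : RiemannHypothesis
  · exact exists_multiSite_re_le_ratio_of_riemannHypothesis hRH E c x t₁ hε
  · obtain ⟨a, -, -, g, hg, -, hnorm, hW⟩ :=
      exists_weilQuadratic_lt_of_not_riemannHypothesis hRH (4 * ∑ i ∈ E, |c i|) 0
    refine ⟨g, hg, by rw [hnorm]; exact one_pos, ?_⟩
    have h := multiSiteQuadratic_re_le E c x hg
    have hPt := abs_siteSymbol_le E c x t₁
    rw [hnorm] at h ⊢
    linarith [neg_abs_le (siteSymbol E c x t₁)]

/-! ## §42 The defect energy density is `2 inf P` -/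

/-- Under RH: `Re Q_{E,c,x}(g) ≥ 2 (inf_t P(t)) ‖g‖₂²` (Plancherel lower bound of part VIII-a and
`W(g ⋆ g̃) ≥ 0`, Weil's criterion, imported). [this work] -/
theorem multiSiteQuadratic_re_ge_of_riemannHypothesis (hRH : RiemannHypothesis) {ι : Type*}
    (E : Finset ι) (c x : ι → ℝ) {g : ℝ → ℂ} (hg : IsWeilTest g) :
    2 * (⨅ t, siteSymbol E c x t) * ∫ u, ‖g u‖ ^ 2 ≤ (multiSiteQuadratic E c x g).re := by
  have hW : 0 ≤ (weilQuadratic g).re := by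
    rw [← siteQuadratic_zero 0 g]
    exact (siteQuadratic_zero_nonneg_iff_riemannHypothesis 0).2 hRH g hg
  have h := multiSiteQuadratic_re_ge_of_le_siteSymbol hg (E := E) (c := c) (x := x)
    (m := ⨅ t, siteSymbol E c x t) fun t ↦ ciInf_le (bddBelow_range_siteSymbol E c x) t
  linarith

/-- The set of defect energy densities `Re Q_{E,c,x}(g)/‖g‖₂²` over test functions with
`‖g‖₂ > 0`. [this work] -/
def multiDefectEnergySet {ι : Type*} (E : Finset ι) (c x : ι → ℝ) : Set ℝ :=
  {q | ∃ g : ℝ → ℂ, IsWeilTest g ∧ 0 < ∫ u, ‖g u‖ ^ 2 ∧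
    q = (multiSiteQuadratic E c x g).re / ∫ u, ‖g u‖ ^ 2}

/-- **Under RH the defect energy density is exactly `2 inf_t P(t)`.** [this work] -/
theorem isGLB_multiDefectEnergySet_of_riemannHypothesis (hRH : RiemannHypothesis) {ι : Type*}
    (E : Finset ι) (c x : ι → ℝ) :
    IsGLB (multiDefectEnergySet E c x) (2 * ⨅ t, siteSymbol E c x t) := by
  constructor
  · rintro q ⟨g, hg, hm, rfl⟩
    rw [le_div_iff₀ hm]
    exact multiSiteQuadratic_re_ge_of_riemannHypothesis hRH E c x hg
  · intro b hb
    by_contra h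
    push Not at h
    have hlt : (⨅ t, siteSymbol E c x t) < b / 2 := by linarith
    obtain ⟨t₁, ht₁⟩ := exists_lt_of_ciInf_lt hlt
    obtain ⟨g, hg, hm, hq⟩ := exists_multiSite_re_le_ratio E c x t₁
      (by linarith : 0 < (b - 2 * siteSymbol E c x t₁) / 2)
    have h1 := hb ⟨g, hg, hm, rfl⟩
    rw [le_div_iff₀ hm] at h1
    nlinarith

/-- **Under `¬RH` the defect energy density is `-∞`.** [this work] -/
theorem not_bddBelow_multiDefectEnergySet_of_not_riemannHypothesis (hRH : ¬ RiemannHypothesis)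
    {ι : Type*} (E : Finset ι) (c x : ι → ℝ) : ¬ BddBelow (multiDefectEnergySet E c x) := by
  rintro ⟨B, hB⟩
  refine hRH (riemannHypothesis_of_multiSite_lower_bound (E := E) (c := c) (x := x) (B := B)
    fun g hg hm ↦ ?_)
  have h := hB ⟨g, hg, hm, rfl⟩
  rwa [le_div_iff₀ hm] at h

/-- **Dichotomy**: RH iff the defect energy density of `Q_{E,c,x}` is finite. [this work] -/
theorem riemannHypothesis_iff_bddBelow_multiDefectEnergySet {ι : Type*} (E : Finset ι)
    (c x : ι → ℝ) : RiemannHypothesis ↔ BddBelow (multiDefectEnergySet E c x) := by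
  constructor
  · exact fun hRH ↦ ⟨_, (isGLB_multiDefectEnergySet_of_riemannHypothesis hRH E c x).1⟩
  · intro h
    by_contra hRH
    exact not_bddBelow_multiDefectEnergySet_of_not_riemannHypothesis hRH E c x h

/-! ## §43 The symbol criterion -/

/-- **SYMBOL CRITERION (RH-free statement).**  For a finitely supported even perturbation
`∑_{i ∈ E} c_i (δ_{x_i} + δ_{-x_i})` of `ζ`'s explicit-formula measure (arbitrary real sites):
`W + ∑ c_i (δ_{x_i} + δ_{-x_i})` is positive on the test class iff RH holds and the symbol
`P(t) = ∑ c_i cos(t x_i)` is nonnegative for all `t`.  (`c = 0`: Weil's criterion, imported;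
RH is NOT claimed.) [this work] -/
theorem multiSiteQuadratic_nonneg_iff_symbol {ι : Type*} (E : Finset ι) (c x : ι → ℝ) :
    (∀ g : ℝ → ℂ, IsWeilTest g → 0 ≤ (multiSiteQuadratic E c x g).re) ↔
      RiemannHypothesis ∧ ∀ t, 0 ≤ siteSymbol E c x t := by
  constructor
  · intro h
    refine ⟨riemannHypothesis_of_multiSite_lower_bound (E := E) (c := c) (x := x) (B := 0)
      fun g hg _ ↦ by rw [zero_mul]; exact h g hg, fun t₁ ↦ ?_⟩
    by_contra hneg
    push Not at hneg
    obtain ⟨g, hg, hm, hq⟩ := exists_multiSite_re_le_ratio E c x t₁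
      (by linarith : 0 < -siteSymbol E c x t₁)
    have h1 := h g hg
    nlinarith
  · rintro ⟨hRH, hP⟩ g hg
    have hW : 0 ≤ (weilQuadratic g).re := by
      rw [← siteQuadratic_zero 0 g]
      exact (siteQuadratic_zero_nonneg_iff_riemannHypothesis 0).2 hRH g hg
    have h := multiSiteQuadratic_re_ge_of_le_siteSymbol hg (m := 0) hP
    have : (0 : ℝ) ≤ ∫ u, ‖g u‖ ^ 2 := integral_nonneg fun u ↦ by positivity
    linarith

/-! ## §44 Consequences: shielding by the origin; tables -/

/-- **Mass at the origin shields defects.**  Under RH, if some site is the origin,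
`x_{i₀} = 0`, and its coefficient dominates, `c_{i₀} ≥ ∑_{i ≠ i₀} |c_i|`, then the perturbed form
IS positive on the test class — in contrast with the width-zero theorem for sites `≠ 0`
(parts III-b, IV-b). [this work] -/
theorem multiSiteQuadratic_nonneg_of_dominant_origin (hRH : RiemannHypothesis) {ι : Type*}
    [DecidableEq ι] {E : Finset ι} {c x : ι → ℝ} {i₀ : ι} (hi₀ : i₀ ∈ E) (hx₀ : x i₀ = 0)
    (hdom : ∑ i ∈ E.erase i₀, |c i| ≤ c i₀) :
    ∀ g : ℝ → ℂ, IsWeilTest g → 0 ≤ (multiSiteQuadratic E c x g).re := by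
  refine (multiSiteQuadratic_nonneg_iff_symbol E c x).2 ⟨hRH, fun t ↦ ?_⟩
  rw [siteSymbol, ← Finset.add_sum_erase E _ hi₀, hx₀, mul_zero, Real.cos_zero, mul_one]
  have h := abs_siteSymbol_le (E.erase i₀) c x t
  rw [siteSymbol] at h
  linarith [neg_abs_le (∑ i ∈ E.erase i₀, c i * Real.cos (t * x i))]

/-- **Tables.**  For a weight table `w` differing from `ζ`'s only on a finite set `E`
(entries `n = 0, 1` allowed: they sit at the origin `log 0 = log 1 = 0`):
`Positivity (tableDatum w) ↔ RH ∧ ∀ t, 0 ≤ ∑_{n ∈ E} (Λ(n)/√n - w(n)) cos(t log n)`.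
[this work] -/
theorem finiteEdit_positivity_iff_symbol {E : Finset ℕ} {w : ℕ → ℝ}
    (hw : ∀ n ∉ E, w n = zetaTable n) :
    (tableDatum w).Positivity ↔
      RiemannHypothesis ∧ ∀ t, 0 ≤ siteSymbol E (fun n ↦ zetaTable n - w n)
        (fun n : ℕ ↦ Real.log (n : ℝ)) t := by
  rw [← multiSiteQuadratic_nonneg_iff_symbol]
  unfold ExplicitDatum.Positivity
  constructor
  · intro h g hg
    rw [← finiteEdit_quadratic_eq hw hg]
    exact h g hg
  · intro h g hg
    rw [finiteEdit_quadratic_eq hw hg]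
    exact h g hg

end Summit.RiemannHypothesis.RiemannHypothesis.Theorems.PfPersistenceCoefficientRigidity

end
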